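import Summits.ABC.IUTFork.Cor312NotPointwiseDHVol
import Summits.ABC.IUTFork.Cor312VolumesPadicLatticeFamily
import Summits.ABC.IUTFork.Cor312ThetaBoxesDH
import Literature.IUT.LogVolume.TensorPacketModelScaled
import Literature.IUT.LogVolume.TensorPacketVolume
import Literature.IUT.LogVolume.TensorPacketOrbitContent
import Literature.IUT.LogVolume.TensorPacketShellHull
import HarnessLib

/-!
# [IUTchIII] Corollary 3.12 — the Θ-side local term of ANY typed setting over a `p`-adic presentation is bounded by the
# per-summand CONTENT HULLS `hull(p^{m(v⃗)}·log_p(R_{v⃗}^×))` (G1-Θ unit (U1)-HULL, sharp per-summand form)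

PROOF-ONLY support file (D-0012; no definitions, no `Prop` facts) of the abc-iut cell (R2 S-chain team, seat
abc-iut-s2-p7, TARGET #2 `hΘ`; G1-Θ unit (U1) of abc-iut-w5-d166's `HOME/staging/w5/w5-d166/g4/G1-THETA-SHAPES.md`).
TAKES NO SIDE on [IUTchIII] Cor. 3.12.

[IUTchIII] Cor. 3.12 (kurims May-2020 manuscript `paper:url-4b091feeb646`, p. 173 l. 43 – p. 174 l. 3) reads `−|log(Θ)|`
as the procession-normalised log-volume of "the holomorphic hull of the union of the possible images of a Θ-pilot object …
subject to the indeterminacies (Ind1), (Ind2), (Ind3)"; [IUTchIV] Thm. 1.10 Step (v) (kurims Apr-2020 manuscript p. 27–28)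
bounds its `v_ℚ = p` component summand by summand through the inclusions
`(Ind2-orbit of the slots) ⊆ p^{⌊λ−d_I−a_I⌋}·log_p(R_I^×) ⊆ p^{⌊λ−d_I−a_I⌋−b_I}·(R_I)^∼`; Dupuy–Hilado (arXiv:2004.13228) §4.9
footnote / §4.12: (Ind2) acts through `Aut_{ℚ_p}(V : I)`, the hull of `Ω ⊂ L` is "the smallest polydisc containing `Ω`".

In abc-iut-c312-7's FROZEN typing (`Cor312Statement`): `thetaLocal j v_ℚ = logvol (thetaHull j v_ℚ)`,
`thetaHull = (frame j v_ℚ).hull (⋃₀ possibleImages)`, the possible images being the translates of the (Ind3)-region by the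
group generated by abc-iut-c312-1's (Ind1)/(Ind2) families. THIS FILE proves, GENERICALLY over ANY `Cor312.Setting P` carrying
abc-iut-c312-6's `BridgeHyps` and ANY `p`-adic presentation `Pr` of the signature at `v_ℚ` (abc-iut-c312-5/c312-1
`Cor312Vol.PadicPresentation`: summands `X_{v⃗} = K_{v_0} ⊗_{ℚ_p} ⋯ ⊗_{ℚ_p} K_{v_j}`) whose hull frame at `(j, v_ℚ)` is the
pulled-back real frame of `Pr` and whose log-volume is `Pr`'s weighted summand log-measure on product regions:

* `preimage_pi_smul_normalizedPacket_mem_hul` — the pull-back `e⁻¹(Π_{v⃗} g_{v⃗}·(R_I)^∼)` of a box of nondegenerate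
  translates is a HULL-SET of the pulled-back real frame (abc-iut-c312-3 `factorMap_preimage_hullSet_centreOf`);
* `permX_image_zpow_smul_logPacket` / `image_zpow_smul_logPacket_of_mem_indTwo` — the `p`-power lattice family
  `Λ_{v⃗} = p^{m(v⃗)}·log_p(R_{v⃗}^×)` with a capsule-SYMMETRIC exponent is permutation-compatible and (Ind2)-stable (abc-iut-w5-d250
  `family_image_preimage_pi` then makes `e⁻¹(Π_{v⃗} Λ_{v⃗})` stable under the whole indeterminacy group);
* **`thetaLocal_untopD_le_sum_of_stable_family`** — if the (Ind3)-region lies in `e⁻¹(Π_{v⃗} Λ_{v⃗})` for ANY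
  permutation-compatible (Ind2)-stable family `Λ` trapped in nondegenerate translates `g_{v⃗}·(R_I)^∼`, then
  `−|log(Θ)|_{j,v_ℚ} ≤ Σ_{v⃗} w(v⃗)·log μ̄_{v⃗}(g_{v⃗}·(R_I)^∼)` (abc-iut-c312-10/w4-d107's `thetaLocal_untopD_le_logvol_of_stable_subset`
  with the stable set and the enclosing hull-set separated, here summand by summand);
* **`thetaLocal_untopD_le_sum_content`** — the CONTENT form: if the (Ind3)-region lies in `e⁻¹(Π_{v⃗} p^{m(v⃗)}·log_p(R_{v⃗}^×))`
  (`m` symmetric) then `−|log(Θ)|_{j,v_ℚ} ≤ Σ_{v⃗} w(v⃗)·(−m(v⃗)·log p + Σ_a log ‖h_{v⃗,a}‖)` for ANY nonzero `h_{v⃗,a} ∈ K_{v_a}` with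
  `log_p(R_{v⃗}^×) ⊆ (⊗_a h_{v⃗,a})·(R_I)^∼` (abc-iut-S1 `exists_logPacket_subset_purePacket_smul_normalizedPacket`: `ord(h_a) = −b_a`;
  with the max-norm log-units the bracket is abc-iut-c312-3's `log μ̄(hull(log_p(R_{v⃗}^×)))`, `packetLogμ_packetHull_logPacket_eq_sum`)
  — the SAME affine shape as abc-iut-c312-3's exact genuine number `negLogThetaDH_ofInput_eq_of_content` (`LDHGenuineExactVolume`),
  so that at the M-level setting (unit P6) and at the K-level setting (C-R16 R1, v5) the Θ-side identification `hΘ` reduces to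
  choosing `m` = the contents of the slot unions;
* `thetaLocal_le_coe_of_untopD_le` — the `WithTop` form consumed by abc-iut-w5-d166's reduction `negLogTheta_le_sum_add`.

[cite: Mochizuki2012, IUTchIII Cor. 3.12 p. 173–174] [cite: Mochizuki2012, IUTchIV Thm. 1.10 Step (v) p. 27–28]
[cite: DupuyHilado2025, §4.7, §4.9, §4.12] [claim: Mochizuki2012, status: disputed] for every quoted construction.
HONEST FRAMING: an UPPER bound on OUR typed `thetaLocal` by volumes of OUR typed containers; nothing here asserts or denies
[IUTchIII] Cor. 3.12 or takes a side on any author; typed ≠ proved; instantiated ≠ endorsed. The instantiation at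
abc-iut-c312-7's `Real.settingPrVolSharp` is the companion `Cor312PilotIdelesPrContentBound`.
-/

noncomputable section

open Set Function
open scoped Pointwise

namespace Summit.ABC.IUTFork.Cor312Vol

open Thm311 Cor312 Literature.IUT.LogThetaLattice Literature.IUT.LogVolume

namespace PadicPresentation

variable {T : ThetaIndex} {L : LogShells T} {vQ : T.VQ} {p : ℕ} [hp : Fact p.Prime]
  (Pr : PadicPresentation L vQ p) {j : T.Label}

/-! ## §1. Boxes of nondegenerate translates are hull-sets of the pulled-back real frame -/

/-- **`e⁻¹(Π_{v⃗} g_{v⃗}·(R_I)^∼)` is a hull-set of the pulled-back real frame** `HullFrame.ofComparison` along the field-factor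
comparison of the presentation, for nondegenerate centres `g_{v⃗}` (all `ψ_{v⃗}(g_{v⃗})_i ≠ 0`): it is the preimage of the
hull-set `λ·𝒪_L`, `λ = centreOf g` ([IUTchIII] Rmk. 3.9.5 (ii) "subsets of the form `λ·𝒪`"; abc-iut-c312-3
`factorMap_preimage_hullSet_centreOf`). [cite: Mochizuki2012, IUTchIII Rmk. 3.9.5 (ii) p. 127] -/
theorem preimage_pi_smul_normalizedPacket_mem_hul [Fintype (Pr.factorIdx j)] (g : ∀ e : T.Caps j → T.Fibre vQ, Pr.X e)
    (hg : ∀ e i, dEquiv p (Pr.kk e) (g e) i ≠ 0) :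
    (Pr.comparison j ⁻¹' Set.pi univ fun e => g e • (normalizedPacket p (Pr.kk e) : Set (Pr.X e))) ∈
      (HullFrame.ofComparison (Pr.factorField j) (fun x => Pr.factorMap j x)).Hul :=
  ⟨hullSet (Pr.factorField j) (Pr.centreOf g), ⟨Pr.centreOf g, fun s => hg s.1 s.2, rfl⟩,
    (Pr.factorMap_preimage_hullSet_centreOf g hg).symm⟩

/-! ## §2. The `p`-power lattice family `p^{m(v⃗)}·log_p(R_{v⃗}^×)` is permutation-compatible and (Ind2)-stable -/

/-- An element of abc-iut-c312-3's (Ind2)-group of a summand maps `c·log_p(R_I^×)` onto itself.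
[cite: DupuyHilado2025, §4.9] -/
theorem image_smul_logPacket_of_mem_indTwo {e : T.Caps j → T.Fibre vQ} {ψ : Pr.X e ≃ₗ[ℚ_[p]] Pr.X e}
    (hψ : ψ ∈ indTwo p (Pr.kk e)) (c : ℚ_[p]) :
    ψ '' (c • (logPacket p (Pr.kk e) : Set (Pr.X e))) = c • (logPacket p (Pr.kk e) : Set (Pr.X e)) := by
  rw [image_const_smul p (Pr.kk e) ψ c, image_logPacket_of_mem p (Pr.kk e) hψ]

/-- The factor permutation `perm_σ : X_{v⃗∘σ} ≃ X_{v⃗}` maps `c·log_p(R^×_{v⃗∘σ})` onto `c·log_p(R^×_{v⃗})` ("This map … fixes the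
lattice"). [cite: DupuyHilado2025, §4.7] -/
theorem permX_image_smul_logPacket (σ : Equiv.Perm (T.Caps j)) (e : T.Caps j → T.Fibre vQ) (c : ℚ_[p]) :
    Pr.permX σ e '' (c • (logPacket p (Pr.kk (e ∘ σ)) : Set (Pr.X (e ∘ σ)))) =
      c • (logPacket p (Pr.kk e) : Set (Pr.X e)) := by
  show ⇑(permAlgEquiv p (Pr.kk e) σ) '' (c • (logPacket p (fun i => Pr.kk e (σ i)) : Set _)) =
    c • (logPacket p (Pr.kk e) : Set (Pr.X e))
  rw [image_const_smul_perm, image_logPacket_perm]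

end PadicPresentation

/-! ## §3. The Θ-side local term under a `p`-adic presentation of the setting's packet -/

section Setting

open PadicPresentation

variable {T : ThetaIndex} {S : Situation T} {P : Cor312.Setting S} {vQ : T.VQ} {p : ℕ} [hp : Fact p.Prime]
  (Pr : PadicPresentation S.L vQ p)

/-- **The union of ALL possible images lies in `e⁻¹(Π_{v⃗} p^{m(v⃗)}·log_p(R_{v⃗}^×))`** as soon as the (Ind3)-region does, for a
capsule-symmetric exponent `m(v⃗∘σ) = m(v⃗)` ([IUTchIV] Step (v): every (Ind1)/(Ind2)-translate of the slots stays in the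
`p^m·log_p(R_I^×)`; abc-iut-w5-d250 `family_image_preimage_pi` + abc-iut-c312-7 `sUnion_possibleImages_subset`).
[cite: Mochizuki2012, IUTchIV Thm. 1.10 Step (v) p. 27–28] -/
theorem sUnion_possibleImages_subset_preimage_pi_zpow_smul_logPacket (j : T.Label)
    (m : (T.Caps j → T.Fibre vQ) → ℤ)
    (hm : ∀ (σ : Equiv.Perm (T.Caps j)) (e : T.Caps j → T.Fibre vQ), m (e ∘ σ) = m e)
    (h3 : P.thetaRegion3 j vQ ⊆ Pr.comparison j ⁻¹' Set.pi univ fun e =>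
      ((p : ℚ_[p]) ^ m e) • (logPacket p (Pr.kk e) : Set (Pr.X e))) :
    ⋃₀ P.possibleImages j vQ ⊆ Pr.comparison j ⁻¹' Set.pi univ fun e =>
      ((p : ℚ_[p]) ^ m e) • (logPacket p (Pr.kk e) : Set (Pr.X e)) :=
  P.sUnion_possibleImages_subset
    (fun Φ hΦ => Pr.family_image_preimage_pi hΦ _ (fun σ e => by rw [hm σ e]; exact Pr.permX_image_smul_logPacket σ e _)
      (fun e ψ hψ => Pr.image_smul_logPacket_of_mem_indTwo hψ _)) h3

/-- **`−|log(Θ)|_{j,v_ℚ} ≤ Σ_{v⃗} w(v⃗)·log μ̄_{v⃗}(g_{v⃗}·(R_I)^∼)` for ANY stable family trapped in nondegenerate translates.** Let the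
setting `P` carry abc-iut-c312-6's `BridgeHyps`, let its hull frame at `(j, v_ℚ)` (`j = i+1 ∈ 𝔽_l^⋇`) be the pulled-back real frame of
the presentation `Pr` and its log-volume on product regions be `Pr`'s weighted summand log-measure. If the (Ind3)-region lies in
`e⁻¹(Π_{v⃗} Λ_{v⃗})` for a permutation-compatible, (Ind2)-stable family `Λ` with `Λ_{v⃗} ⊆ g_{v⃗}·(R_I)^∼` (`g_{v⃗}` nondegenerate), then
the hull of the union of ALL possible images lies in the hull-set `e⁻¹(Π_{v⃗} g_{v⃗}·(R_I)^∼)` and the local Θ-volume is at most its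
log-volume ([IUTchIII] proof of Cor. 3.12, p. 175 l. 2–4; [IUTchIV] Thm. 1.10 Step (v); Dupuy–Hilado §4.12).
[cite: Mochizuki2012, IUTchIV Thm. 1.10 Step (v) p. 27–28] -/
theorem thetaLocal_untopD_le_sum_of_stable_family (H : BridgeHyps P) (i : Fin T.lstar)
    [Fintype (Pr.factorIdx (Cor312.Setting.labelSucc i))] [Fintype (T.Caps (Cor312.Setting.labelSucc i) → T.Fibre vQ)]
    (hframe : P.frame (Cor312.Setting.labelSucc i) vQ =
      HullFrame.ofComparison (Pr.factorField (Cor312.Setting.labelSucc i))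
        (fun x => Pr.factorMap (Cor312.Setting.labelSucc i) x))
    (hvol : ∀ R : ∀ e : T.Caps (Cor312.Setting.labelSucc i) → T.Fibre vQ, Set (Pr.X e),
      (∀ e, PacketAdm p (Pr.kk e) (R e)) →
        (S.D P.n).logvol (Cor312.Setting.labelSucc i) vQ
          (Pr.comparison (Cor312.Setting.labelSucc i) ⁻¹' Set.pi univ R) =
        ∑ e, Pr.w (Cor312.Setting.labelSucc i) e * packetLogμ p (Pr.kk e) (R e))
    (Λ : ∀ e : T.Caps (Cor312.Setting.labelSucc i) → T.Fibre vQ, Set (Pr.X e))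
    (hperm : ∀ (σ : Equiv.Perm (T.Caps (Cor312.Setting.labelSucc i)))
      (e : T.Caps (Cor312.Setting.labelSucc i) → T.Fibre vQ), Pr.permX σ e '' Λ (e ∘ σ) = Λ e)
    (hind : ∀ (e : T.Caps (Cor312.Setting.labelSucc i) → T.Fibre vQ) (ψ : Pr.X e ≃ₗ[ℚ_[p]] Pr.X e),
      ψ ∈ indTwo p (Pr.kk e) → ψ '' Λ e = Λ e)
    (h3 : P.thetaRegion3 (Cor312.Setting.labelSucc i) vQ ⊆
      Pr.comparison (Cor312.Setting.labelSucc i) ⁻¹' Set.pi univ Λ)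
    (g : ∀ e : T.Caps (Cor312.Setting.labelSucc i) → T.Fibre vQ, Pr.X e)
    (hg : ∀ e k, dEquiv p (Pr.kk e) (g e) k ≠ 0)
    (hΛg : ∀ e, Λ e ⊆ g e • (normalizedPacket p (Pr.kk e) : Set (Pr.X e))) :
    (P.thetaLocal (Cor312.Setting.labelSucc i) vQ).untopD 0 ≤
      ∑ e, Pr.w (Cor312.Setting.labelSucc i) e *
        packetLogμ p (Pr.kk e) (g e • (normalizedPacket p (Pr.kk e) : Set (Pr.X e))) := by
  have hHul : (Pr.comparison (Cor312.Setting.labelSucc i) ⁻¹' Set.pi univ fun e =>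
      g e • (normalizedPacket p (Pr.kk e) : Set (Pr.X e))) ∈ (P.frame (Cor312.Setting.labelSucc i) vQ).Hul := by
    rw [hframe]
    exact Pr.preimage_pi_smul_normalizedPacket_mem_hul g hg
  have hle := thetaLocal_untopD_le_logvol_of_stable_subset H i vQ
    (W := Pr.comparison (Cor312.Setting.labelSucc i) ⁻¹' Set.pi univ Λ)
    (Hs := Pr.comparison (Cor312.Setting.labelSucc i) ⁻¹' Set.pi univ fun e =>
      g e • (normalizedPacket p (Pr.kk e) : Set (Pr.X e)))
    (fun Φ hΦ => Pr.family_image_preimage_pi hΦ Λ hperm hind) h3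
    (Set.preimage_mono (Set.pi_mono fun e _ => hΛg e)) hHul
  rw [hvol _ (fun e => packetAdm_smul_normalizedPacket p (Pr.kk e) (g e) (hg e))] at hle
  exact hle

/-- **THE CONTENT FORM — `−|log(Θ)|_{j,v_ℚ} ≤ Σ_{v⃗} w(v⃗)·(−m(v⃗)·log p + Σ_a log ‖h_{v⃗,a}‖)`**: if the (Ind3)-region lies in
`e⁻¹(Π_{v⃗} p^{m(v⃗)}·log_p(R_{v⃗}^×))` for a capsule-symmetric exponent `m`, and `log_p(R_{v⃗}^×) ⊆ (⊗_a h_{v⃗,a})·(R_I)^∼` with all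
`h_{v⃗,a} ≠ 0` ([IUTchIV] Prop. 1.2 (i) p. 10, fourth inclusion: `ord(h_a) = −b_a`), then every possible image lies in
`e⁻¹(Π_{v⃗} (p^{m(v⃗)}·⊗_a h_{v⃗,a})·(R_I)^∼)`, whose weighted log-volume is the stated sum ([IUTchIV] Prop. 1.4 (iii): the log-volume
of `p^λ·(R_I)^∼`; abc-iut-S1 `packetLogVolume_ppow_mul_purePacket_smul`). With `h_{v⃗,·}` the max-norm log-units the bracket is
`log μ̄(hull(p^{m(v⃗)}·log_p(R_{v⃗}^×)))` (abc-iut-c312-3 `packetLogμ_packetHull_logPacket_eq_sum`) — the summand of abc-iut-c312-3's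
exact genuine number `negLogThetaDH_ofInput_eq_of_content`. [cite: Mochizuki2012, IUTchIV Thm. 1.10 Step (v) p. 27–28] -/
theorem thetaLocal_untopD_le_sum_content (H : BridgeHyps P) (i : Fin T.lstar)
    [Fintype (Pr.factorIdx (Cor312.Setting.labelSucc i))] [Fintype (T.Caps (Cor312.Setting.labelSucc i) → T.Fibre vQ)]
    (hframe : P.frame (Cor312.Setting.labelSucc i) vQ =
      HullFrame.ofComparison (Pr.factorField (Cor312.Setting.labelSucc i))
        (fun x => Pr.factorMap (Cor312.Setting.labelSucc i) x))
    (hvol : ∀ R : ∀ e : T.Caps (Cor312.Setting.labelSucc i) → T.Fibre vQ, Set (Pr.X e),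
      (∀ e, PacketAdm p (Pr.kk e) (R e)) →
        (S.D P.n).logvol (Cor312.Setting.labelSucc i) vQ
          (Pr.comparison (Cor312.Setting.labelSucc i) ⁻¹' Set.pi univ R) =
        ∑ e, Pr.w (Cor312.Setting.labelSucc i) e * packetLogμ p (Pr.kk e) (R e))
    (m : (T.Caps (Cor312.Setting.labelSucc i) → T.Fibre vQ) → ℤ)
    (hm : ∀ (σ : Equiv.Perm (T.Caps (Cor312.Setting.labelSucc i)))
      (e : T.Caps (Cor312.Setting.labelSucc i) → T.Fibre vQ), m (e ∘ σ) = m e)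
    (h3 : P.thetaRegion3 (Cor312.Setting.labelSucc i) vQ ⊆
      Pr.comparison (Cor312.Setting.labelSucc i) ⁻¹' Set.pi univ fun e =>
        ((p : ℚ_[p]) ^ m e) • (logPacket p (Pr.kk e) : Set (Pr.X e)))
    (h : ∀ e : T.Caps (Cor312.Setting.labelSucc i) → T.Fibre vQ, ∀ a, Pr.kk e a)
    (hh : ∀ e a, h e a ≠ 0)
    (hsub : ∀ e, (logPacket p (Pr.kk e) : Set (Pr.X e)) ⊆
      purePacket p (Pr.kk e) (h e) • (normalizedPacket p (Pr.kk e) : Set (Pr.X e))) :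
    (P.thetaLocal (Cor312.Setting.labelSucc i) vQ).untopD 0 ≤
      ∑ e, Pr.w (Cor312.Setting.labelSucc i) e * (-(m e * Real.log p) + ∑ a, Real.log ‖h e a‖) := by
  haveI : Nonempty (T.Caps (Cor312.Setting.labelSucc i)) := ⟨0⟩
  -- the enclosing translates `(p^{m(v⃗)}·⊗_a h_{v⃗,a})·(R_I)^∼`
  set g : ∀ e : T.Caps (Cor312.Setting.labelSucc i) → T.Fibre vQ, Pr.X e :=
    fun e => ppow p (Pr.kk e) (m e) * purePacket p (Pr.kk e) (h e) with hgdef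
  have hg : ∀ e k, dEquiv p (Pr.kk e) (g e) k ≠ 0 := by
    intro e k
    rw [hgdef, map_mul, Pi.mul_apply]
    exact mul_ne_zero
      (((isUnit_ppow p (Pr.kk e) (m e)).map (dEquiv p (Pr.kk e))).map (Pi.evalRingHom _ k)).ne_zero
      (dEquiv_purePacket_ne_zero p (Pr.kk e) (hh e) k)
  have hΛg : ∀ e, ((p : ℚ_[p]) ^ m e) • (logPacket p (Pr.kk e) : Set (Pr.X e)) ⊆
      g e • (normalizedPacket p (Pr.kk e) : Set (Pr.X e)) := by
    intro e
    rw [hgdef, mul_smul, ← ppow_smul_set_eq]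
    exact Set.smul_set_mono (hsub e)
  have hle := thetaLocal_untopD_le_sum_of_stable_family Pr H i hframe hvol
    (fun e => ((p : ℚ_[p]) ^ m e) • (logPacket p (Pr.kk e) : Set (Pr.X e)))
    (fun σ e => by rw [hm σ e]; exact Pr.permX_image_smul_logPacket σ e _)
    (fun e ψ hψ => Pr.image_smul_logPacket_of_mem_indTwo hψ _) h3 g hg hΛg
  refine hle.trans (le_of_eq (Finset.sum_congr rfl fun e _ => ?_))
  rw [hgdef]
  exact congrArg _ (packetLogVolume_ppow_mul_purePacket_smul p (Pr.kk e) (DFac p (Pr.kk e)) (dEquiv p (Pr.kk e))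
    (m e) (h e) (hh e))

/-- **THE CONTENT-HULL FORM — `−|log(Θ)|_{j,v_ℚ} ≤ Σ_{v⃗} w(v⃗)·(−m(v⃗)·log p + log μ̄_{v⃗}(hull(log_p(R_{v⃗}^×))))`**: the bound of
`thetaLocal_untopD_le_sum_content` at the max-norm log-units (abc-iut-c312-3 `exists_family_isMaxOn_logUnits`,
`packetLogμ_packetHull_logPacket_eq_sum`), i.e. by the weighted log-measures of the CONTENT HULLS
`hull(p^{m(v⃗)}·log_p(R_{v⃗}^×))` — literally the summand shape of abc-iut-c312-3's exact genuine number
`negLogThetaDH_ofInput_eq_of_content` / `realPrimePacketWith_negLogThetaAt_eq_of_content` (there with EQUALITY for the full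
(Ind2) group; here `≤`, the presented signature's (Ind2) being the tensor families of lattice automorphisms).
[cite: Mochizuki2012, IUTchIV Thm. 1.10 Step (v) p. 27–28] [cite: DupuyHilado2025, §4.12] -/
theorem thetaLocal_untopD_le_sum_content_hull (H : BridgeHyps P) (i : Fin T.lstar)
    [Fintype (Pr.factorIdx (Cor312.Setting.labelSucc i))] [Fintype (T.Caps (Cor312.Setting.labelSucc i) → T.Fibre vQ)]
    (hframe : P.frame (Cor312.Setting.labelSucc i) vQ =
      HullFrame.ofComparison (Pr.factorField (Cor312.Setting.labelSucc i))
        (fun x => Pr.factorMap (Cor312.Setting.labelSucc i) x))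
    (hvol : ∀ R : ∀ e : T.Caps (Cor312.Setting.labelSucc i) → T.Fibre vQ, Set (Pr.X e),
      (∀ e, PacketAdm p (Pr.kk e) (R e)) →
        (S.D P.n).logvol (Cor312.Setting.labelSucc i) vQ
          (Pr.comparison (Cor312.Setting.labelSucc i) ⁻¹' Set.pi univ R) =
        ∑ e, Pr.w (Cor312.Setting.labelSucc i) e * packetLogμ p (Pr.kk e) (R e))
    (m : (T.Caps (Cor312.Setting.labelSucc i) → T.Fibre vQ) → ℤ)
    (hm : ∀ (σ : Equiv.Perm (T.Caps (Cor312.Setting.labelSucc i)))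
      (e : T.Caps (Cor312.Setting.labelSucc i) → T.Fibre vQ), m (e ∘ σ) = m e)
    (h3 : P.thetaRegion3 (Cor312.Setting.labelSucc i) vQ ⊆
      Pr.comparison (Cor312.Setting.labelSucc i) ⁻¹' Set.pi univ fun e =>
        ((p : ℚ_[p]) ^ m e) • (logPacket p (Pr.kk e) : Set (Pr.X e))) :
    (P.thetaLocal (Cor312.Setting.labelSucc i) vQ).untopD 0 ≤
      ∑ e, Pr.w (Cor312.Setting.labelSucc i) e * (-(m e * Real.log p) +
        packetLogμ p (Pr.kk e) (packetHull p (Pr.kk e) (logPacket p (Pr.kk e) : Set (Pr.X e)))) := by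
  haveI : Nonempty (T.Caps (Cor312.Setting.labelSucc i)) := ⟨0⟩
  have hz : ∀ e : T.Caps (Cor312.Setting.labelSucc i) → T.Fibre vQ, ∃ z : ∀ a, Pr.kk e a,
      (∀ a, z a ∈ logUnits (Pr.kk e a)) ∧ ∀ a, ∀ w ∈ logUnits (Pr.kk e a), ‖w‖ ≤ ‖z a‖ :=
    fun e => exists_family_isMaxOn_logUnits p (Pr.kk e)
  choose z hzmem hzmax using hz
  have hz0 : ∀ e a, z e a ≠ 0 := fun e a => ne_zero_of_isMaxOn_logUnits p (Pr.kk e a) (hzmax e a)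
  refine (thetaLocal_untopD_le_sum_content Pr H i hframe hvol m hm h3 z hz0
    (fun e => logPacket_subset_purePacket_smul_normalizedPacket_of_isMaxOn p (Pr.kk e) (hzmax e))).trans
    (le_of_eq (Finset.sum_congr rfl fun e _ => ?_))
  rw [packetLogμ_packetHull_logPacket_eq_sum p (Pr.kk e) (hzmem e) (hzmax e)]

/-- The `WithTop` form of a real upper bound on the local Θ-volume (under `BridgeHyps` the local term is a real number), as
consumed by abc-iut-w5-d166's reduction `negLogTheta_le_sum_add`. [folklore] -/
theorem thetaLocal_le_coe_of_untopD_le (H : BridgeHyps P) (i : Fin T.lstar) (vQ : T.VQ) {b : ℝ}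
    (hb : (P.thetaLocal (Cor312.Setting.labelSucc i) vQ).untopD 0 ≤ b) :
    P.thetaLocal (Cor312.Setting.labelSucc i) vQ ≤ ((b : ℝ) : WithTop ℝ) := by
  have hne : P.thetaLocal (Cor312.Setting.labelSucc i) vQ ≠ ⊤ := H.finite.1 i vQ
  obtain ⟨x, hx⟩ := WithTop.ne_top_iff_exists.mp hne
  rw [← hx] at hb ⊢
  rw [WithTop.untopD_coe] at hb
  exact WithTop.coe_le_coe.mpr hb

end Setting

end Summit.ABC.IUTFork.Cor312Vol

end
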